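import Summits.QuantumFields.BalabanUV.T4Continuum.Support.ShellMeasureRootCompositionHistoriesSync
import Summits.QuantumFields.BalabanUV.T4Continuum.Support.ShellMeasureThresholdUnits

/-!
# `T4Continuum.ShellMeasureThresholdUnitsHistories` — owner audit (γ8), file 3: the histories-road END-I with node
# U1b's `LocalRate` CONSUMED BY NAME (the closeness binder and the rate discharged in threshold units; kernel plumbing)
(cell `pub-balaban`, sub-cell `t4`, spine estimate NE7c (node U5b); owner lineage `b2b-balaban-t4-ne7c-p1` gen 33, owner
table `t4/b2b-balaban-t4-ne7c-p1/LEAVES-NE7c-P1.md` row **S90 f3**; owner NOTE N-ne7cp1-g33-1; ADDITIVE — imports the crew's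
`ShellMeasureRootCompositionHistoriesSync` (leaf-05; END-I for history-indexed term families, thresholds by age) and S90
f1 `ShellMeasureThresholdUnits` (p229839) ONLY, cited BY NAME; [folklore]; 0 `def`, 0 `def … : Prop`, 0 sorry, 0 citation
tags)

HONEST FRAMING.  Finite four-torus programme, rung (B)+1 only — NOT infinite volume, NOT a mass gap, NOT the Clay
problem, NOT summit progress; (B), `BetaPertHyp`, (B^μ) not consumed.  NE7c (`T4IndicatorShell.ShellWeightBound`) is NOT
PRINTED in [Balaban 1983–89] and NOT PROVED; «NE7c ⇐ the named binders» (trigger c3).  Nothing printed is asserted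
here; no estimate of Bałaban's or of node U1b's is discharged: node U1b's output SHAPE `T4EtaRateMin.LocalRate R C ϑ`
(NE3 species, NOT PRINTED for Bałaban's minimisers; printed linear TEMPLATE [King1986] (3.71)) enters as a HYPOTHESIS.

WHAT THIS FILE DOES (N-ne7cp1-g33-1 item (2) at END-I level).  The END-I of record for term families of B14 (2.17)–(2.18)
TYPE, `ShellMeasureRootCompositionHistoriesSync.shellWeightBound_histories_age`, displays TWO node-U1b binders by name:
the a.e. closeness `hcloseA`∕`hcloseB : |uA − uB| ≤ ρ (lvl K s) · ε (K − lvl K s)` under each run's term weights and the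
rate `hrate : ρ j ≤ c₁ϑ^j` (with `0 ≤ ρ`).  In THRESHOLD UNITS both ARE node U1b's liaison data
(`T4SupCloseLiaison`): here they are DISCHARGED from (i) `LocalRate R C ϑ` for ONE reading family `R`, (ii) the
`ReadsLevels`-type a.e. identities «run A's variable of slot `s` IS the `lvl K s`-step reading, run B's IS the
`(lvl K s + 1)`-step reading of `R` at a common admissible datum» under BOTH runs' term weights, (iii) the floor on the
NORMALISED age profile over the window, `θmin ≤ ε a` for `a ≤ N₁` (`T4SupCloseLiaison` §5d) — the width becoming
`ρ_j := geomWidth C θmin ϑ j = (C∕θmin)ϑ^j` (`hρ0`, `hrate` automatic).  Result: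
**`shellWeightBound_histories_age_of_localRate`** — END-I with W-f (WALL §3) consumed BY NAME in U1b's own shape; the
conclusion LITERALLY `ShellWeightBound …` with `Wsh K = Σ_{s∈C K} (DA + DB)(lvl s)·geomWidth C θmin ϑ (lvl s)`.  Displayed
remain: per-slot (M1) for the partial laws (THE WALL, at width `geomWidth …`), (W1) `LiveWindow`, `D ≤ D̄`, measurability,
and U1b's three data (i)–(iii).  The raw-fine reading of (ii) would be false on every live shell
(`ShellMeasureThresholdUnits.fineCurrency_closeness_fails`) — (ii) is stated for the variables END-I uses, i.e. in
threshold units.  NOTHING in the countdown moves; NE7c NOT PROVED; spine PROVED 0∕9.  HONEST DEPENDENCY (cell): continuum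
YM on T⁴ ⇐ BetaPertH ∧ nine spine estimates (0/9 proved); BetaPertH ⇐ (D1) ∧ (D4) ∧ CAP+tail; G-an2-4 gates asym, D1 and
NE2/3/4.
-/

noncomputable section

open Set MeasureTheory Finset

namespace Summit.QuantumFields.BalabanUV.T4Continuum.ShellMeasureThresholdUnitsHistories

open scoped ENNReal
open Literature.MathematicalPhysics.QuantumFieldTheory.Balaban1983to89
open T4ShellMeasure (SlotAntiConcentration)
open T4ShellMeasureLevels (LiveWindow)
open T4IndicatorShell (ShellWeightBound)
open T4EtaRateMin (Readings LocalRate)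
open T4SupCloseLiaison (geomWidth geomWidth_nonneg geomWidth_le_rate)
open ShellMeasureThresholdUnits (close_of_localRate)
open ShellMeasureRootCompositionHistories (histWeight histShell partialLaw)
open ShellMeasureRootCompositionHistoriesSync (shellWeightBound_histories_age)

/-! ## §1 The floor over the live window and the symmetric closeness -/

/-- **THE WINDOW FLOOR**: under (W1) every live slot has age `≤ N₁`, so a floor on the normalised age profile over
`a ≤ N₁` bounds every live slot's threshold below (`T4SupCloseLiaison.thresholdFloor_of_ageLower_window`, slot form).
[folklore] -/
theorem floor_of_liveWindow {σ : Type*} {C : ℕ → Finset σ} {lvl : ℕ → σ → ℕ} {N₁ : ℕ} {νbar θmin : ℝ}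
    {ε : ℕ → ℝ} (hw : LiveWindow C lvl N₁ νbar) (hfloorN : ∀ a ≤ N₁, θmin ≤ ε a) :
    ∀ K, ∀ s ∈ C K, θmin ≤ ε (K - lvl K s) := by
  intro K s hs
  have h := hw.recent K s hs
  exact hfloorN _ (by omega)

/-- **a.e. CLOSENESS, RUNS SWAPPED**: the same realisation identities give `|uB − uA| ≤ ρ_j·εa` a.e. [folklore] -/
theorem hclose_of_localRate_symm {Ω Dat Sit : Type*} [MeasurableSpace Ω] {R : Readings Dat Sit}
    {C ϑ θmin εa : ℝ} {j : ℕ} {ν : Measure Ω} {rA rB : Ω → ℝ} (hloc : LocalRate R C ϑ)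
    (hR : ∀ᵐ ω ∂ν, ∃ V ∈ R.dom, ∃ x : Sit, rA ω = R.loc j V x ∧ rB ω = R.loc (j + 1) V x)
    (hmin : 0 < θmin) (hε : θmin ≤ εa) :
    ∀ᵐ ω ∂ν, |rB ω - rA ω| ≤ geomWidth C θmin ϑ j * εa := by
  filter_upwards [hR] with ω hω
  obtain ⟨V, hV, x, hA, hB⟩ := hω
  rw [abs_sub_comm]
  exact close_of_localRate hloc hV hA hB hmin hε

/-! ## §2 END-I (histories road, thresholds by age) with node U1b's `LocalRate` by name -/

section TwoRuns

variable {Ω : ℕ → Type*} [∀ K, MeasurableSpace (Ω K)] {σ ι : Type*} [DecidableEq σ] {T : ℕ → Finset ι}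
  {C : ℕ → Finset σ} {small : ℕ → ι → Finset σ} {lvl : ℕ → σ → ℕ} {νA νB : ∀ K : ℕ, ℝ → ι → Measure (Ω K)}
  [∀ K t τ, IsFiniteMeasure (νA K t τ)] [∀ K t τ, IsFiniteMeasure (νB K t τ)]
  {uA uB : ∀ K : ℕ, ℝ → σ → Ω K → ℝ} {DA DB : ℕ → ℝ} {l₀ : ℝ} {N₁ : ℕ} {νbar Dbar : ℝ}
  {Dat Sit : Type*} {R : Readings Dat Sit} {Cr ϑ θmin : ℝ} {ε : ℕ → ℝ}

/-- **END-I FOR HISTORY-INDEXED TERM FAMILIES WITH NODE U1b's `LocalRate` CONSUMED BY NAME.**  The binders of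
`ShellMeasureRootCompositionHistoriesSync.shellWeightBound_histories_age` with `hcloseA`, `hcloseB`, `hρ0`, `hrate`
DISCHARGED from: `LocalRate R Cr ϑ` (`0 ≤ Cr`, `0 < ϑ < 1`), the a.e. realisation identities `hRA`∕`hRB` (run A's tested
variable of slot `s` IS `R.loc (lvl K s)`, run B's IS `R.loc (lvl K s + 1)`, at a common admissible datum — under each
run's term weights, for the variables END-I uses, i.e. in THRESHOLD UNITS), and the window floor `θmin ≤ ε a (a ≤ N₁)`,
`0 < θmin`; width `ρ_j := geomWidth Cr θmin ϑ j`.  Displayed remain the per-slot (M1) for the partial laws at that width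
(THE WALL), (W1), `D ≤ D̄`, measurability.  CONCLUSION LITERALLY `ShellWeightBound …`.  CONDITIONAL; nothing printed
asserted; `LocalRate` is node U1b's NOT-PRINTED output shape, not discharged here. [folklore] -/
theorem shellWeightBound_histories_age_of_localRate
    (hloc : LocalRate R Cr ϑ) (hCr : 0 ≤ Cr) (hϑ0 : 0 < ϑ) (hϑ1 : ϑ < 1) (hmin : 0 < θmin)
    (hfloorN : ∀ a ≤ N₁, θmin ≤ ε a)
    (huA : ∀ K t s, Measurable (uA K t s)) (huB : ∀ K t s, Measurable (uB K t s))
    (hsmall : ∀ K, ∀ τ ∈ T K, small K τ ⊆ C K)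
    (hRA : ∀ K t, |t| ≤ l₀ → ∀ τ ∈ T K, ∀ s ∈ small K τ, ∀ᵐ ω ∂(νA K t τ), ∃ V ∈ R.dom, ∃ x : Sit,
      uA K t s ω = R.loc (lvl K s) V x ∧ uB K t s ω = R.loc (lvl K s + 1) V x)
    (hRB : ∀ K t, |t| ≤ l₀ → ∀ τ ∈ T K, ∀ s ∈ small K τ, ∀ᵐ ω ∂(νB K t τ), ∃ V ∈ R.dom, ∃ x : Sit,
      uA K t s ω = R.loc (lvl K s) V x ∧ uB K t s ω = R.loc (lvl K s + 1) V x)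
    (hDA0 : ∀ j, 0 ≤ DA j) (hDB0 : ∀ j, 0 ≤ DB j)
    (hacA : ∀ K t, |t| ≤ l₀ → ∀ s ∈ C K,
      SlotAntiConcentration (partialLaw (T K) (νA K t) (small K) (uA K t) (fun s => ε (K - lvl K s)) s) (uA K t s)
        (ε (K - lvl K s)) (geomWidth Cr θmin ϑ (lvl K s)) (DA (lvl K s)))
    (hacB : ∀ K t, |t| ≤ l₀ → ∀ s ∈ C K,
      SlotAntiConcentration (partialLaw (T K) (νB K t) (small K) (uB K t) (fun s => ε (K - lvl K s)) s) (uB K t s)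
        (ε (K - lvl K s)) (geomWidth Cr θmin ϑ (lvl K s)) (DB (lvl K s)))
    (hw : LiveWindow C lvl N₁ νbar) (hDA : ∀ j, DA j ≤ Dbar) (hDB : ∀ j, DB j ≤ Dbar) :
    ShellWeightBound l₀ T
      (fun K t τ => histWeight (νA K t τ) (small K τ) (uA K t) (fun s => ε (K - lvl K s)))
      (fun K t τ => histWeight (νB K t τ) (small K τ) (uB K t) (fun s => ε (K - lvl K s)))
      (fun K t τ => histShell (νA K t τ) (small K τ) (uA K t) (uB K t) (fun s => ε (K - lvl K s)))
      (fun K t τ => histShell (νB K t τ) (small K τ) (uB K t) (uA K t) (fun s => ε (K - lvl K s)))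
      (fun K => ∑ s ∈ C K, DA (lvl K s) * geomWidth Cr θmin ϑ (lvl K s) +
        ∑ s ∈ C K, DB (lvl K s) * geomWidth Cr θmin ϑ (lvl K s)) := by
  have hfl := floor_of_liveWindow hw hfloorN
  exact shellWeightBound_histories_age (ρ := geomWidth Cr θmin ϑ) (c₁ := Cr / θmin) huA huB hsmall
    (fun K t ht τ hτ s hs =>
      ShellMeasureThresholdUnits.hclose_of_localRate hloc (hRA K t ht τ hτ s hs) hmin (hfl K s (hsmall K τ hτ hs)))
    (fun K t ht τ hτ s hs => hclose_of_localRate_symm hloc (hRB K t ht τ hτ s hs) hmin (hfl K s (hsmall K τ hτ hs)))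
    hDA0 hDB0 (geomWidth_nonneg hCr hmin.le hϑ0.le) hacA hacB hw hϑ0 hϑ1 hDA hDB
    (fun j => geomWidth_le_rate Cr θmin ϑ j)

end TwoRuns

end Summit.QuantumFields.BalabanUV.T4Continuum.ShellMeasureThresholdUnitsHistories

end
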